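import Mathlib.Analysis.Matrix.Normed
import Literature.Barriers.MatrixMultiplication.QuasirandomBarrier
import Literature.RepresentationTheory.FiniteGroups.FourierInversionIdentity
import Literature.RepresentationTheory.FiniteGroups.UnitaryWedderburn
import Literature.Combinatorics.Additive.TPPGroupAlgebra
import Literature.MathematicalPhysics.QuantumLattice.TracePowerInequalities
import HarnessLib

/-!
# Proof of the quasirandomness barrier (Blasiak–Cohn–Grochow–Pratt–Umans 2023, Thm. 3.2)

Topic `Literature/Barriers/MatrixMultiplication`. This file DISCHARGES the named facts of
`QuasirandomBarrier.lean`: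

* `BCGPU2023_thm32_holds : BCGPU2023_thm32` — "If subsets `S`, `T`, and `U` satisfy the triple
  product property in a finite nonabelian group `G`, then `|S||T||U| ≤ |G|^{3/2}/n(G)^{1/2} + |G|`"
  (Thm. 3.2; the hypothesis "nonabelian" is not used: if no irreducible block has dimension `> 1`
  the argument gives `|S||T||U| ≤ |G|`);
* `BCGPU2023_cor35_holds` (Cor. 3.5, via the in-tree derivation `BCGPU2023_thm32.cor35`) and the
  catalogue entry `QuasirandomBarrier_holds : QuasirandomBarrier`.

The proof is the printed one (p. 6), "following the Fourier-analytic proof of Gowers' theorem on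
mixing in quasirandom groups", on a **unitary Wedderburn decomposition**
`φ : ℂ[G] ≃ₐ[ℂ] ∏ᵢ ℂ^{dᵢ×dᵢ}` (`exists_unitary_algEquiv_pi_matrix`): with `𝟙_X = ∑_{x∈X} x`,
`A = φ(𝟙_{S⁻¹}𝟙_T)`, `B = φ(𝟙_{T⁻¹}𝟙_U)`, `C = φ(𝟙_{U⁻¹}𝟙_S)`,
1. Fourier inversion at `1` (`card_mul_coeff_one_eq_sum_trace`) and the TPP count
   (`TripleProductProperty.coeff_one_six`): `|G||S||T||U| = ∑ᵢ dᵢ tr(Aᵢ Bᵢ Cᵢ)`;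
2. blocks with `dᵢ = 1` contribute `|a|²|t|²|u|² ≥ 0` (`trace_cyclic_nonneg_of_subsingleton`),
   the trivial block (`exists_trivial_block`) contributes `(|S||T||U|)²`;
3. Parseval (`parseval_of_adjoint` with `TripleProductProperty.coeff_one_four`):
   `∑ᵢ dᵢ ‖Aᵢ‖²_F = |G||S||T|` (and cyclically), so `‖Aᵢ‖²_F ≤ |G||S||T|/n(G)` when `dᵢ > 1`
   (`dᵢ ∈ charDegrees G`, `blockDegree_mem_charDegrees`, hence `n(G) ≤ dᵢ`); here
   `‖X‖²_F = Re tr(Xᴴ X)` throughout;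
4. `|tr(Aᵢ Bᵢ Cᵢ)| ≤ ‖Aᵢ‖_F ‖Bᵢ‖_F ‖Cᵢ‖_F` (`norm_trace_mul_mul_le`: the trace Cauchy–Schwarz
   inequality of the tree,
   `Literature.MathematicalPhysics.QuantumLattice.norm_trace_mul_le_sqrt_mul_sqrt`,
   plus submultiplicativity of the Frobenius norm, Mathlib's `Matrix.frobenius_norm_mul`) and
   Cauchy–Schwarz over `i` (`Real.sum_sqrt_mul_sqrt_le`) bound the `dᵢ > 1` terms by
   `|S||T||U| |G|^{3/2}/n(G)^{1/2}`.

Matrix facts reused rather than restated: `tr(X Xᴴ) = ∑|Xᵢⱼ|²` and the trace Cauchy–Schwarz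
inequality live in `Literature/MathematicalPhysics/QuantumLattice/TracePowerInequalities.lean`
(`trace_mul_conjTranspose_self_eq`, `trace_conjTranspose_mul_self_re`,
`norm_trace_mul_le_sqrt_mul_sqrt`); the Frobenius norm and its submultiplicativity are Mathlib's
(`Matrix.Norms.Frobenius`, `Matrix.frobenius_norm_mul`).

## References

* J. Blasiak, H. Cohn, J. A. Grochow, K. Pratt, C. Umans, *Matrix multiplication via matrix
  groups*, ITCS 2023, LIPIcs 251, 19:1–19:16, arXiv:2204.03826 (held: `paper:arxiv-2204.03826`),
  Thm. 3.2 and its proof (p. 6), Cor. 3.5 (p. 7). [BlasiakCohnGrochowPrattUmans2023]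
-/

noncomputable section

open scoped BigOperators Matrix ComplexOrder

namespace Literature.Barriers.MatrixMultiplication

open Literature.RepresentationTheory.FiniteGroups Literature.Combinatorics.Additive
open Literature.MathematicalPhysics.QuantumLattice (trace_mul_conjTranspose_self_eq
  trace_conjTranspose_mul_self_re norm_trace_mul_le_sqrt_mul_sqrt)

section MatrixBounds

variable {m : Type*} [Fintype m]

/-- `0 ≤ Re tr(Xᴴ X)` (`= ∑ |Xᵢⱼ|²`, the squared Frobenius norm; companion of the tree's
`trace_mul_conjTranspose_self_re_nonneg` for `X Xᴴ`). [folklore] -/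
theorem re_trace_conjTranspose_mul_self_nonneg (X : Matrix m m ℂ) : 0 ≤ (Xᴴ * X).trace.re := by
  rw [trace_conjTranspose_mul_self_re]
  exact Finset.sum_nonneg fun _ _ => Finset.sum_nonneg fun _ _ => by positivity

open scoped Matrix.Norms.Frobenius in
/-- **Submultiplicativity of the Frobenius norm in trace form**:
`Re tr((BC)ᴴ(BC)) ≤ Re tr(Bᴴ B) · Re tr(Cᴴ C)`, i.e. `‖B C‖_F² ≤ ‖B‖_F² ‖C‖_F²` — Mathlib's
`Matrix.frobenius_norm_mul`, squared, with `‖X‖_F² = Re tr(Xᴴ X)`. [folklore] -/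
theorem re_trace_conjTranspose_mul_self_mul_le (B C : Matrix m m ℂ) :
    ((B * C)ᴴ * (B * C)).trace.re ≤ (Bᴴ * B).trace.re * (Cᴴ * C).trace.re := by
  have hsq : ∀ X : Matrix m m ℂ, ‖X‖ ^ 2 = (Xᴴ * X).trace.re := fun X => by
    rw [trace_conjTranspose_mul_self_re, Matrix.frobenius_norm_def, ← Real.sqrt_eq_rpow,
      Real.sq_sqrt (Finset.sum_nonneg fun _ _ => Finset.sum_nonneg fun _ _ => by positivity)]
    simp
  rw [← hsq, ← hsq, ← hsq, ← mul_pow]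
  exact pow_le_pow_left₀ (norm_nonneg _) (Matrix.frobenius_norm_mul B C) 2

/-- `|tr(A B C)| ≤ ‖A‖_F ‖B‖_F ‖C‖_F` with `‖X‖_F = (Re tr Xᴴ X)^{1/2}` (the trace Cauchy–Schwarz
inequality `norm_trace_mul_le_sqrt_mul_sqrt` of the tree applied to `A · (B C)`, then
submultiplicativity; the bound used on the "`d_π > 1`" terms in Blasiak–Cohn–Grochow–Pratt–Umans
2023, proof of Thm. 3.2). [folklore] -/
theorem norm_trace_mul_mul_le (A B C : Matrix m m ℂ) :
    ‖(A * B * C).trace‖ ≤ Real.sqrt ((Aᴴ * A).trace.re) *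
      (Real.sqrt ((Bᴴ * B).trace.re) * Real.sqrt ((Cᴴ * C).trace.re)) := by
  have h := norm_trace_mul_le_sqrt_mul_sqrt A (B * C)
  rw [← Matrix.mul_assoc, Matrix.trace_mul_comm A Aᴴ] at h
  refine h.trans (mul_le_mul_of_nonneg_left ?_ (Real.sqrt_nonneg _))
  rw [← Real.sqrt_mul (re_trace_conjTranspose_mul_self_nonneg B)]
  exact Real.sqrt_le_sqrt (re_trace_conjTranspose_mul_self_mul_le B C)

/-- On `1 × 1` matrices the cyclic product `aᴴ t tᴴ u uᴴ a` has non-negative real trace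
(`= |a|²|t|²|u|²`; the "`d_π = 1`" terms in BCGPU 2023, proof of Thm. 3.2: "`π(S)π(S⁻¹) = |π(S)|²`,
which is a nonnegative real number"). [folklore] -/
theorem trace_cyclic_nonneg_of_subsingleton [Subsingleton m] (a t u : Matrix m m ℂ) :
    0 ≤ ((aᴴ * t) * (tᴴ * u) * (uᴴ * a)).trace.re := by
  rcases isEmpty_or_nonempty m with hm | ⟨⟨i⟩⟩
  · simp [Matrix.trace]
  · have hmul : ∀ X Y : Matrix m m ℂ, (X * Y) i i = X i i * Y i i := fun X Y => by
      rw [Matrix.mul_apply, Fintype.sum_subsingleton _ i]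
    have htr : ∀ X : Matrix m m ℂ, X.trace = X i i := fun X => by
      rw [Matrix.trace, Fintype.sum_subsingleton _ i, Matrix.diag]
    rw [htr, hmul, hmul, hmul, hmul, hmul, Matrix.conjTranspose_apply, Matrix.conjTranspose_apply,
      Matrix.conjTranspose_apply]
    have : star (a i i) * t i i * (star (t i i) * u i i) * (star (u i i) * a i i) =
        ((‖a i i‖ ^ 2 * ‖t i i‖ ^ 2 * ‖u i i‖ ^ 2 : ℝ) : ℂ) := by
      rw [show star (a i i) * t i i * (star (t i i) * u i i) * (star (u i i) * a i i) =
        (star (a i i) * a i i) * (star (t i i) * t i i) * (star (u i i) * u i i) by ring]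
      simp only [Complex.star_def, Complex.conj_mul']
      push_cast
      ring
    rw [this, Complex.ofReal_re]
    positivity

end MatrixBounds

section Unitary

variable {G : Type} [Group G] {r : ℕ} {d : Fin r → ℕ}
  (φ : MonoidAlgebra ℂ G ≃ₐ[ℂ] BlockAlgebraC d)

/-- Under a unitary decomposition, `φ(𝟙_{X⁻¹})ᵢ = φ(𝟙_X)ᵢᴴ` ("`π(X⁻¹) = π(X)^*`" for unitary `π`).
[cite: BlasiakCohnGrochowPrattUmans2023, Thm. 3.2 (proof)] -/
theorem algEquiv_indicatorElemInv_eq_conjTranspose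
    (hφ : ∀ (g : G) (i : Fin r),
      (φ (MonoidAlgebra.single g 1) i)ᴴ * φ (MonoidAlgebra.single g 1) i = 1)
    (X : Finset G) (i : Fin r) : φ (indicatorElemInv ℂ X) i = (φ (indicatorElem ℂ X) i)ᴴ := by
  rw [indicatorElemInv_def, indicatorElem_def, map_sum, map_sum, Finset.sum_apply, Finset.sum_apply,
    Matrix.conjTranspose_sum]
  exact Finset.sum_congr rfl fun g _ => algEquiv_single_inv_eq_conjTranspose φ hφ g i

/-- **Parseval through the blocks**: if `φ y = (φ x)ᴴ` blockwise then
`∑ᵢ dᵢ ‖(φ x)ᵢ‖²_F = |G| · (y x)(1)` with `‖X‖²_F = Re tr(Xᴴ X)` ("`∑_g |f(g)|² =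
|G|⁻¹ ∑_π d_π ‖f̂(π)‖²`", BCGPU 2023, proof of Thm. 3.2, from Fourier inversion at `1` applied to
`f^* * f`). [cite: BlasiakCohnGrochowPrattUmans2023, Thm. 3.2 (proof)] -/
theorem parseval_of_adjoint [Fintype G] (x y : MonoidAlgebra ℂ G) (hxy : ∀ i, φ y i = (φ x i)ᴴ) :
    ((∑ i, (d i : ℝ) * ((φ x i)ᴴ * φ x i).trace.re : ℝ) : ℂ) =
      (Fintype.card G : ℂ) * (y * x).coeff 1 := by
  rw [card_mul_coeff_one_eq_sum_trace φ, Complex.ofReal_sum]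
  refine Finset.sum_congr rfl fun i _ => ?_
  rw [map_mul, Pi.mul_apply, hxy, Matrix.trace_mul_comm, trace_mul_conjTranspose_self_eq,
    Complex.ofReal_re]
  push_cast
  ring

end Unitary

/-- `|G|^{3/2} = |G| √|G|`. [folklore] -/
theorem rpow_three_halves {x : ℝ} (hx : 0 < x) : x ^ (3 / 2 : ℝ) = x * Real.sqrt x := by
  rw [show (3 / 2 : ℝ) = 1 + 1 / 2 by norm_num, Real.rpow_add hx, Real.rpow_one,
    Real.sqrt_eq_rpow]

/-- **BCGPU 2023, Theorem 3.2, proved**: if `S, T, U` satisfy the triple product property in a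
finite group `G` then `|S||T||U| ≤ |G|^{3/2}/n(G)^{1/2} + |G|`, with `n(G) = secondCharDegree G`
(the hypothesis that `G` be non-abelian, carried by the named fact, is not needed).
[cite: BlasiakCohnGrochowPrattUmans2023, Thm. 3.2] -/
theorem BCGPU2023_thm32_holds : BCGPU2023_thm32 := by
  intro G _ _ _ S T U hTPP
  classical
  -- degenerate case: one of the sets is empty
  by_cases hN0 : S.card * T.card * U.card = 0
  · rw [hN0, Nat.cast_zero]
    positivity
  have hS : S.Nonempty := Finset.card_ne_zero.1 fun h => hN0 (by simp [h])
  have hT : T.Nonempty := Finset.card_ne_zero.1 fun h => hN0 (by simp [h])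
  have hU : U.Nonempty := Finset.card_ne_zero.1 fun h => hN0 (by simp [h])
  -- a unitary Wedderburn decomposition and its trivial block
  obtain ⟨r, d, hd, φ, hφ⟩ := exists_unitary_algEquiv_pi_matrix G
  obtain ⟨i₀, hdi₀, hφi₀⟩ := exists_trivial_block φ
  -- notation
  set N : ℕ := S.card * T.card * U.card with hN
  set cG : ℝ := (Fintype.card G : ℝ) with hcG
  set n : ℝ := (secondCharDegree G : ℝ) with hn
  set a : ∀ i : Fin r, Matrix (Fin (d i)) (Fin (d i)) ℂ := fun i => φ (indicatorElem ℂ S) i with ha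
  set t : ∀ i : Fin r, Matrix (Fin (d i)) (Fin (d i)) ℂ := fun i => φ (indicatorElem ℂ T) i with ht
  set u : ∀ i : Fin r, Matrix (Fin (d i)) (Fin (d i)) ℂ := fun i => φ (indicatorElem ℂ U) i with hu
  set A : ∀ i : Fin r, Matrix (Fin (d i)) (Fin (d i)) ℂ := fun i => (a i)ᴴ * t i with hA
  set B : ∀ i : Fin r, Matrix (Fin (d i)) (Fin (d i)) ℂ := fun i => (t i)ᴴ * u i with hB
  set C : ∀ i : Fin r, Matrix (Fin (d i)) (Fin (d i)) ℂ := fun i => (u i)ᴴ * a i with hC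
  have hPA : ∀ i, φ (indicatorElemInv ℂ S * indicatorElem ℂ T) i = A i := fun i => by
    rw [map_mul, Pi.mul_apply, algEquiv_indicatorElemInv_eq_conjTranspose φ hφ]
  have hQB : ∀ i, φ (indicatorElemInv ℂ T * indicatorElem ℂ U) i = B i := fun i => by
    rw [map_mul, Pi.mul_apply, algEquiv_indicatorElemInv_eq_conjTranspose φ hφ]
  have hRC : ∀ i, φ (indicatorElemInv ℂ U * indicatorElem ℂ S) i = C i := fun i => by
    rw [map_mul, Pi.mul_apply, algEquiv_indicatorElemInv_eq_conjTranspose φ hφ]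
  -- (1) Fourier inversion at `1` + TPP count: `|G| N = ∑ dᵢ tr(Aᵢ Bᵢ Cᵢ)`
  have h1 : (cG * N : ℝ) = ∑ i, (d i : ℝ) * (A i * B i * C i).trace.re := by
    have h := card_mul_coeff_one_eq_sum_trace φ
      ((indicatorElemInv ℂ S * indicatorElem ℂ T) * (indicatorElemInv ℂ T * indicatorElem ℂ U) *
        (indicatorElemInv ℂ U * indicatorElem ℂ S))
    rw [hTPP.coeff_one_six] at h
    simp only [map_mul, Pi.mul_apply] at h
    simp only [map_mul, Pi.mul_apply] at hPA hQB hRC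
    simp only [hPA, hQB, hRC] at h
    have h' := congrArg Complex.re h
    rw [Complex.re_sum] at h'
    simpa [hcG, hN] using h'
  -- (2) Parseval: `∑ dᵢ ‖Aᵢ‖² = |G||S||T|` and cyclically
  have h2A : ∑ i, (d i : ℝ) * ((A i)ᴴ * A i).trace.re = cG * (S.card * T.card) := by
    have h := parseval_of_adjoint φ (indicatorElemInv ℂ S * indicatorElem ℂ T)
      (indicatorElemInv ℂ T * indicatorElem ℂ S) fun i => by
      rw [hPA, map_mul, Pi.mul_apply, algEquiv_indicatorElemInv_eq_conjTranspose φ hφ, hA]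
      simp only [Matrix.conjTranspose_mul, Matrix.conjTranspose_conjTranspose]
      rfl
    rw [hTPP.coeff_one_four hU] at h
    simp only [hPA] at h
    rw [hcG]
    exact_mod_cast h
  have h2B : ∑ i, (d i : ℝ) * ((B i)ᴴ * B i).trace.re = cG * (T.card * U.card) := by
    have h := parseval_of_adjoint φ (indicatorElemInv ℂ T * indicatorElem ℂ U)
      (indicatorElemInv ℂ U * indicatorElem ℂ T) fun i => by
      rw [hQB, map_mul, Pi.mul_apply, algEquiv_indicatorElemInv_eq_conjTranspose φ hφ, hB]
      simp only [Matrix.conjTranspose_mul, Matrix.conjTranspose_conjTranspose]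
      rfl
    rw [hTPP.rotate.coeff_one_four hS] at h
    simp only [hQB] at h
    rw [hcG]
    exact_mod_cast h
  have h2C : ∑ i, (d i : ℝ) * ((C i)ᴴ * C i).trace.re = cG * (U.card * S.card) := by
    have h := parseval_of_adjoint φ (indicatorElemInv ℂ U * indicatorElem ℂ S)
      (indicatorElemInv ℂ S * indicatorElem ℂ U) fun i => by
      rw [hRC, map_mul, Pi.mul_apply, algEquiv_indicatorElemInv_eq_conjTranspose φ hφ, hC]
      simp only [Matrix.conjTranspose_mul, Matrix.conjTranspose_conjTranspose]
      rfl
    rw [hTPP.rotate.rotate.coeff_one_four hT] at h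
    simp only [hRC] at h
    rw [hcG]
    exact_mod_cast h
  -- (3) the trivial block contributes `N²`
  have hind : ∀ X : Finset G,
      φ (indicatorElem ℂ X) i₀ = (X.card : ℂ) • (1 : Matrix _ _ ℂ) := fun X => by
    rw [indicatorElem_def, map_sum, Finset.sum_apply]
    simp only [hφi₀, Finset.sum_const, Nat.cast_smul_eq_nsmul]
  have h3 : (d i₀ : ℝ) * (A i₀ * B i₀ * C i₀).trace.re = (N : ℝ) ^ 2 := by
    simp only [hA, hB, hC, ha, ht, hu, hind, Matrix.conjTranspose_smul, Matrix.conjTranspose_one,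
      Matrix.smul_mul, Matrix.mul_smul, Matrix.one_mul, smul_smul, Matrix.trace_smul,
      Matrix.trace_one, Fintype.card_fin, hdi₀, hN]
    simp
    ring
  -- (4) blocks of dimension `1` contribute non-negative reals
  have h4 : ∀ i, d i = 1 → 0 ≤ (d i : ℝ) * (A i * B i * C i).trace.re := by
    intro i hi
    haveI : Subsingleton (Fin (d i)) := by rw [hi]; infer_instance
    exact mul_nonneg (Nat.cast_nonneg _) (trace_cyclic_nonneg_of_subsingleton (a i) (t i) (u i))
  -- (5) blocks of dimension `> 1`
  set K : ℝ := Real.sqrt (cG * (S.card * T.card) / n) with hK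
  have h5 : ∀ i, 1 < d i → (d i : ℝ) * ‖(A i * B i * C i).trace‖ ≤
      K * (Real.sqrt (d i * ((B i)ᴴ * B i).trace.re) *
        Real.sqrt (d i * ((C i)ᴴ * C i).trace.re)) := by
    intro i hi
    have hdi : (0 : ℝ) < d i := by exact_mod_cast (zero_lt_one.trans hi)
    have hnle : n ≤ d i := by
      rw [hn]
      exact_mod_cast (secondCharDegree_le (blockDegree_mem_charDegrees φ i) hi).2
    have hnpos : 0 < n := by
      rw [hn]
      exact_mod_cast
        (zero_lt_two.trans_le (secondCharDegree_le (blockDegree_mem_charDegrees φ i) hi).1)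
    -- `‖Aᵢ‖² ≤ |G||S||T| / n`
    have hAi : ((A i)ᴴ * A i).trace.re ≤ cG * (S.card * T.card) / n := by
      have hle : (d i : ℝ) * ((A i)ᴴ * A i).trace.re ≤ cG * (S.card * T.card) := by
        rw [← h2A]
        exact Finset.single_le_sum (f := fun j => (d j : ℝ) * ((A j)ᴴ * A j).trace.re)
          (fun j _ => mul_nonneg (Nat.cast_nonneg _) (re_trace_conjTranspose_mul_self_nonneg _))
          (Finset.mem_univ i)
      calc ((A i)ᴴ * A i).trace.re ≤ cG * (S.card * T.card) / d i := by
            rw [le_div_iff₀ hdi, mul_comm]; exact hle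
        _ ≤ cG * (S.card * T.card) / n :=
            div_le_div_of_nonneg_left (by positivity) hnpos hnle
    calc (d i : ℝ) * ‖(A i * B i * C i).trace‖
        ≤ d i * (Real.sqrt (((A i)ᴴ * A i).trace.re) *
            (Real.sqrt (((B i)ᴴ * B i).trace.re) * Real.sqrt (((C i)ᴴ * C i).trace.re))) :=
          mul_le_mul_of_nonneg_left (norm_trace_mul_mul_le _ _ _) hdi.le
      _ ≤ d i * (K * (Real.sqrt (((B i)ᴴ * B i).trace.re) *
            Real.sqrt (((C i)ᴴ * C i).trace.re))) := by
          gcongr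
          exact Real.sqrt_le_sqrt hAi
      _ = K * (Real.sqrt (d i * ((B i)ᴴ * B i).trace.re) *
            Real.sqrt (d i * ((C i)ᴴ * C i).trace.re)) := by
          rw [Real.sqrt_mul hdi.le, Real.sqrt_mul hdi.le]
          have := Real.mul_self_sqrt hdi.le
          linear_combination
            (-(K * Real.sqrt (((B i)ᴴ * B i).trace.re) * Real.sqrt (((C i)ᴴ * C i).trace.re))) *
              this
  -- summing (5) over the blocks of dimension `> 1`, with Cauchy–Schwarz
  have h5sum : ∑ i ∈ Finset.univ.filter (fun i => ¬ d i = 1),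
      (d i : ℝ) * ‖(A i * B i * C i).trace‖ ≤
        K * (Real.sqrt (cG * (T.card * U.card)) * Real.sqrt (cG * (U.card * S.card))) := by
    have hne1 : ∀ i, ¬ d i = 1 → 1 < d i := fun i hi => by
      have := (hd i).pos
      omega
    calc ∑ i ∈ Finset.univ.filter (fun i => ¬ d i = 1), (d i : ℝ) * ‖(A i * B i * C i).trace‖
        ≤ ∑ i ∈ Finset.univ.filter (fun i => ¬ d i = 1),
            K * (Real.sqrt (d i * ((B i)ᴴ * B i).trace.re) *
              Real.sqrt (d i * ((C i)ᴴ * C i).trace.re)) :=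
          Finset.sum_le_sum fun i hi => h5 i (hne1 i (Finset.mem_filter.1 hi).2)
      _ ≤ ∑ i, K * (Real.sqrt (d i * ((B i)ᴴ * B i).trace.re) *
            Real.sqrt (d i * ((C i)ᴴ * C i).trace.re)) :=
          Finset.sum_le_univ_sum_of_nonneg fun i => by positivity
      _ = K * ∑ i, Real.sqrt (d i * ((B i)ᴴ * B i).trace.re) *
            Real.sqrt (d i * ((C i)ᴴ * C i).trace.re) := by
          rw [Finset.mul_sum]
      _ ≤ K * (Real.sqrt (∑ i, (d i : ℝ) * ((B i)ᴴ * B i).trace.re) *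
            Real.sqrt (∑ i, (d i : ℝ) * ((C i)ᴴ * C i).trace.re)) := by
          gcongr
          exact Real.sum_sqrt_mul_sqrt_le _
            (fun i => mul_nonneg (Nat.cast_nonneg _)
              (re_trace_conjTranspose_mul_self_nonneg _))
            (fun i => mul_nonneg (Nat.cast_nonneg _)
              (re_trace_conjTranspose_mul_self_nonneg _))
      _ = K * (Real.sqrt (cG * (T.card * U.card)) * Real.sqrt (cG * (U.card * S.card))) := by
          rw [h2B, h2C]
  -- the error term equals `N |G| √|G| / √n`
  have hErr : K * (Real.sqrt (cG * (T.card * U.card)) * Real.sqrt (cG * (U.card * S.card))) =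
      N * (cG * Real.sqrt cG / Real.sqrt n) := by
    have hG0 : 0 ≤ cG := Nat.cast_nonneg _
    have hS' : (0 : ℝ) ≤ S.card := Nat.cast_nonneg _
    have hT' : (0 : ℝ) ≤ T.card := Nat.cast_nonneg _
    have hU' : (0 : ℝ) ≤ U.card := Nat.cast_nonneg _
    rw [hK, Real.sqrt_div (by positivity), Real.sqrt_mul hG0, Real.sqrt_mul hG0, Real.sqrt_mul hG0,
      Real.sqrt_mul hS', Real.sqrt_mul hT', Real.sqrt_mul hU', hN]
    push_cast
    have eG := Real.mul_self_sqrt hG0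
    have eS := Real.mul_self_sqrt hS'
    have eT := Real.mul_self_sqrt hT'
    have eU := Real.mul_self_sqrt hU'
    calc Real.sqrt cG * (Real.sqrt S.card * Real.sqrt T.card) / Real.sqrt n *
          (Real.sqrt cG * (Real.sqrt T.card * Real.sqrt U.card) *
            (Real.sqrt cG * (Real.sqrt U.card * Real.sqrt S.card)))
        = (Real.sqrt S.card * Real.sqrt S.card) * (Real.sqrt T.card * Real.sqrt T.card) *
            (Real.sqrt U.card * Real.sqrt U.card) *
            ((Real.sqrt cG * Real.sqrt cG) * Real.sqrt cG / Real.sqrt n) := by ring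
      _ = S.card * T.card * U.card * (cG * Real.sqrt cG / Real.sqrt n) := by rw [eG, eS, eT, eU]
  -- (6) assemble: `|G| N ≥ N² − N |G|^{3/2}/√n`
  have hsplit := Finset.sum_filter_add_sum_filter_not Finset.univ (fun i => d i = 1)
    (fun i => (d i : ℝ) * (A i * B i * C i).trace.re)
  have hpos : (N : ℝ) ^ 2 ≤ ∑ i ∈ Finset.univ.filter (fun i => d i = 1),
      (d i : ℝ) * (A i * B i * C i).trace.re := by
    rw [← h3]
    exact Finset.single_le_sum (f := fun i => (d i : ℝ) * (A i * B i * C i).trace.re)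
      (fun i hi => h4 i (Finset.mem_filter.1 hi).2) (Finset.mem_filter.2 ⟨Finset.mem_univ _, hdi₀⟩)
  have hneg : -(K * (Real.sqrt (cG * (T.card * U.card)) * Real.sqrt (cG * (U.card * S.card)))) ≤
      ∑ i ∈ Finset.univ.filter (fun i => ¬ d i = 1), (d i : ℝ) * (A i * B i * C i).trace.re := by
    refine (neg_le_neg h5sum).trans ?_
    rw [← Finset.sum_neg_distrib]
    refine Finset.sum_le_sum fun i _ => ?_
    rw [← mul_neg]
    exact mul_le_mul_of_nonneg_left
      ((neg_le_neg (Complex.abs_re_le_norm _)).trans (neg_abs_le _)) (Nat.cast_nonneg _)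
  have hmain : (N : ℝ) ^ 2 - N * (cG * Real.sqrt cG / Real.sqrt n) ≤ cG * N := by
    rw [h1, ← hsplit, ← hErr]
    linarith
  -- conclude
  have hNpos : (0 : ℝ) < N := by exact_mod_cast Nat.pos_of_ne_zero hN0
  have hGpos : (0 : ℝ) < cG := by rw [hcG]; exact_mod_cast Fintype.card_pos
  rw [rpow_three_halves hGpos]
  have : (N : ℝ) ≤ cG * Real.sqrt cG / Real.sqrt n + cG := by
    refine le_of_mul_le_mul_left ?_ hNpos
    nlinarith
  simpa [hN, hcG, hn] using this

/-- **BCGPU 2023, Corollary 3.5, proved** (from Thm. 3.2 via the in-tree derivation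
`BCGPU2023_thm32.cor35`). [cite: BlasiakCohnGrochowPrattUmans2023, Cor. 3.5] -/
theorem BCGPU2023_cor35_holds : BCGPU2023_cor35 :=
  BCGPU2023_thm32_holds.cor35

/-- **The quasirandomness barrier holds**: the catalogue entry `QuasirandomBarrier`
(Thm. 3.2 ∧ Cor. 3.5 of Blasiak–Cohn–Grochow–Pratt–Umans 2023) is a theorem.
[cite: BlasiakCohnGrochowPrattUmans2023, Thm. 3.2 and Cor. 3.5] -/
theorem QuasirandomBarrier_holds : QuasirandomBarrier :=
  ⟨BCGPU2023_thm32_holds, BCGPU2023_cor35_holds⟩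

end Literature.Barriers.MatrixMultiplication

end
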